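import Summits.BirchSwinnertonDyer.BirchSwinnertonDyer.Theorems.KimAtThreeDeepUpperWitnessOfZetaBodyStable
import HarnessLib

/-!
# The deep-keyed witness family from Kato's Euler system with a SHIFTED Kurihara exponent — value rows of the
# shape `s̄ = u · 3^t · (3^α · δ̃_n)` (the good ANOMALOUS rows at `3`; cell `bsd-addord`, seat w2-c3 gen 6; route
# W2 `KimAtThreeKolyvagin`, crux 19076 `DeepUpperAtThree`, child 19562 `DeepUpperAtThreeOffKatoStratum`)

HONEST FRAMING: END-TYPE TOOL theorems with DISPLAYED hypotheses (no definition, no named fact, no `sorry`);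
`ZetaBody` enters as the displayed HYPOTHESIS `hbody` (never obtained); (Λ)-clauses, two-exponent riders and
VALUE ROWS are displayed; nothing is asserted about any curve; nothing booked; BSD is not proved by this.

## What, and why

The companion `KimAtThreeDeepUpperWitnessOfZetaBodyStable` (this seat, p481410) produces acc1's `hPort` binder
(`KatoKuriharaWitnessAt W k t Dk …` at every deep-guarded datum) at ANY reduction type from VALUE ROWS of
n1011's shape `3^t·(1 ⊗ 𝔇x) ≡ s`, `s̄ = u · 3^t · δ̃_n` — one exponent `t` in both places.  At a good
ANOMALOUS `3` the integral twist of the value row has augmentation `3^α · unit` (`α = v₃(#Ẽ(𝔽₃)) = 1`), so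
the value row reads `3^t·(1 ⊗ 𝔇x) ≡ s`, `s̄ = u · 3^t · (3^α · δ̃_n)` (this seat's `valueRow_of_zetaBody_pow`):
the premise keeps exponent `t` (the rider's), the Kurihara clause gains `α`.  This file is the companion with
that value-row shape; the extra `3^α` lands on the Kurihara side of the witness clause, i.e. the witnesses are
`KatoKuriharaWitnessAt W k (t + α) …` — which acc1's END `deepUpper_conclusion_of_port_e_deep` accepts at ANY
exponent.  `α = 0` is the companion.
* ★ `exists_katoKuriharaWitnessAtTwoExp_of_zetaBody_stable_pow` — single depth: `KatoKuriharaWitnessAtTwoExp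
  W k (t + α) e …` from `hstab`, the (Λ)-clauses, RIDER₂ at `(k, t, e)` and the shifted value rows;
* ★★ `deepWitnessFamily_of_zetaBody_stable_pow` — the deep-keyed family `KatoKuriharaWitnessAt W k (t + α) …`;
* ★★★ `exists_shift_deepWitnessFamily_of_zetaBody_pow` — `hstab` discharged (`exists_hstab_three`).
References: [MazurRubin2004] App. A Prop. A.2 / Rem. A.5, Thm. 3.2.4; [Kato2004Asterisque] (8.1.3), §9.4,
Thm. 9.7, Ex. 13.3; [Kim2022StructureSelmer] §2.2.2, Lemma 3.4, §3.2–§3.4, Thm. 3.13; [Rubin2000] Def. 4.4.4;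
[Sakamoto2024] §2, Def. 4.1; acc1 memo W2ACC1-PORTE-19562; this seat's NOTES `## Design (gen 6)`. -/

set_option autoImplicit false
-- the Theorems namespace of a single-conjunct summit repeats the summit name by design (D-0017)
set_option linter.dupNamespace false

noncomputable section
open scoped NumberField TensorProduct ContRepresentation Classical
open CategoryTheory Field Function Finset IsDedekindDomain NumberField WeierstrassCurve
open Rat.HeightOneSpectrum
open Literature.NumberTheory.GaloisRepresentations Literature.NumberTheory.GaloisCohomology
open Literature.NumberTheory.GaloisRepresentations.DiscreteGaloisModule
open Literature.NumberTheory.EllipticCurves Literature.NumberTheory.EllipticCurves.ModularForms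
open Literature.NumberTheory.EllipticCurves.Rank1Residual
open Literature.NumberTheory.EllipticCurves.Kato2004
open Literature.NumberTheory.EllipticCurves.Kato2004.EulerSystemValues
open Summit.BirchSwinnertonDyer.Rank1Residual.GaloisImage
open Summit.BirchSwinnertonDyer.Rank1Residual.GaloisImage.TorsionCoeff
open Summit.BirchSwinnertonDyer.BirchSwinnertonDyer.Theorems.KimAtThreeKolyvaginDefs
open Summit.BirchSwinnertonDyer.BirchSwinnertonDyer.Theorems.KimAtThreeTwoExponentValueLaw
open Summit.BirchSwinnertonDyer.BirchSwinnertonDyer.Theorems.KimAtThreeDeepUpperKolyvaginStableThree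
open Summit.BirchSwinnertonDyer.BirchSwinnertonDyer.Theorems.KimAtThreeDeepUpperAdditiveDefectOfPortE
open Summit.BirchSwinnertonDyer.BirchSwinnertonDyer.Theorems.KimAtThreeDeepUpperDefectWitnessOfZetaBody

open Summit.BirchSwinnertonDyer.BirchSwinnertonDyer.Theorems.KimAtThreeDeepUpperWitnessOfZetaBodyStable

namespace Summit.BirchSwinnertonDyer.BirchSwinnertonDyer.Theorems.KimAtThreeDeepUpperWitnessOfZetaBodyPow

variable (W : WeierstrassCurve ℚ) [W.IsElliptic] [W.IsGloballyMinimal]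
  [ContinuousSMul ℤ_[3] (W.tateModule 3)] [Module.Free ℤ_[3] (W.tateModule 3)]
  [Module.Finite ℤ_[3] (W.tateModule 3)]

/-- Local notation: `𝐃F⟦r, τ⟧ ℓ = Σ_{j<ℓ−1} j·σ_{χ_{m(0,r)}(τ_ℓ)}^j` on the level field `ℚ(ζ_{m(0,r)})`. -/
local notation3 (prettyPrint := false) "𝐃F⟦" r ", " τ "⟧" =>
  fun ℓ : HeightOneSpectrum (𝓞 ℚ) =>
  ∑ j ∈ Finset.range (((primesEquiv ℓ : Nat.Primes) : ℕ) - 1),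
    (j : Module.End ℚ (CyclotomicField (cycLevel 3 0 r) ℚ)) *
      (sigma (cycLevel 3 0 r) (modNCyclotomicCharacter ℚ (cycLevel 3 0 r)
          ((τ : HeightOneSpectrum (𝓞 ℚ) → absoluteGaloisGroup ℚ) ℓ)) :
        CyclotomicField (cycLevel 3 0 r) ℚ →ₐ[ℚ] CyclotomicField (cycLevel 3 0 r) ℚ).toLinearMap ^ j

/-- Local notation: the TWO-EXPONENT rider clause (ii₂) at depth `j`, torsion exponent `t`, defect exponent
`e`, place `v`, for the pair `(Λ, Λf)` — seat acc6's spelling (`KimAtThreeTwoExponentWitnessPair`). -/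
local notation3 (prettyPrint := false) "RIDER₂⟦" W' ", " j ", " t' ", " e' ", " v' ", " Λ' ", " Λf "⟧" =>
  ∀ (r : Finset (HeightOneSpectrum (𝓞 ℚ)))
    (Ψ : H1 (tateRep W' 3) (cycSubgroup 3 0 r) →+
      continuousCohomology 1
        (subgroupRep (WeierstrassCurve.torsionGaloisModule W' (((3 : ℕ) : ℤ) ^ j * ((3 : ℕ) : ℤ))).toTopRep
          (cycSubgroup 3 0 r))),
    (∀ (φ : contOneCocycles (subgroupRep (tateRep W' 3).toTopRep (cycSubgroup 3 0 r)))
        (ψ : contOneCocycles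
          (subgroupRep (WeierstrassCurve.torsionGaloisModule W' (((3 : ℕ) : ℤ) ^ j * ((3 : ℕ) : ℤ))).toTopRep
            (cycSubgroup 3 0 r))),
        (∀ g, ((ψ.1 g : geomTorsion W' (((3 : ℕ) : ℤ) ^ j * ((3 : ℕ) : ℤ))) : geomPoints W') =
          TateModule.proj 3 (j + 1) (φ.1 g)) →
        Ψ (oneCocycleClass _ φ) = oneCocycleClass _ ψ) →
    ∀ (y : H1 (tateRep W' 3) (cycSubgroup 3 0 r))
      (κ₀ : galoisCohomology (WeierstrassCurve.torsionGaloisModule W' (((3 : ℕ) : ℤ) ^ j * ((3 : ℕ) : ℤ))) 1)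
      (s : ℤ_[3]),
      resSubgroup (WeierstrassCurve.torsionGaloisModule W' (((3 : ℕ) : ℤ) ^ j * ((3 : ℕ) : ℤ))).toTopRep
          (cycSubgroup 3 0 r) 1 κ₀ = Ψ y →
      galoisCohomology.localization (WeierstrassCurve.torsionGaloisModule W' (((3 : ℕ) : ℤ) ^ j * ((3 : ℕ) : ℤ)))
          (Sum.inr v') 1 κ₀ ∈ propagatedSelmerStructure W' 3 j (Sum.inr v') →
      (∃ l ∈ cycIntLattice 3 (cycLevel 3 0 r),
          (((3 : ℕ) : ℤ_[3]) ^ t') • Λ' 0 r y - ((s : ℚ_[3]) ⊗ₜ[ℚ] (1 : CyclotomicField (cycLevel 3 0 r) ℚ)) =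
            (((3 : ℕ) : ℤ_[3]) ^ (j + 1)) • (l : ℚ_[3] ⊗[ℚ] CyclotomicField (cycLevel 3 0 r) ℚ)) →
      ((3 ^ e' : ℕ) : ZMod (3 ^ (j + 1))) *
        Λf (galoisCohomology.localization
          (WeierstrassCurve.torsionGaloisModule W' (((3 : ℕ) : ℤ) ^ j * ((3 : ℕ) : ℤ))) (Sum.inr v') 1 κ₀) =
        PadicInt.toZModPow (j + 1) s

/-! ### §1 ★ One depth: the two-exponent witness clauses at ANY reduction type (binder `hstab`) -/

set_option backward.isDefEq.respectTransparency false in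
/-- **★ SINGLE-DEPTH two-exponent witnesses at ANY reduction type at `3`, value rows with a SHIFTED Kurihara
exponent (`s̄ = u·3^t·(3^α·δ̃)`): conclusion `KatoKuriharaWitnessAtTwoExp W k (t + α) e …`.**  For
`W/ℚ` globally minimal, a parametrisation datum `P` (newform `P.f`), Kato's witnesses bound by `hbody`, `E[3]`
irreducible, the torsion-stabilisation binder `hstab` of level `N₀` at the place over `3`, a depth `k`, the (Λ)-clauses `hΛk` and the two-exponent
rider clause (ii₂) `hfin₂k` at `(k, t, e)` for a functional `Λk` at `v₃ ∣ 3`, a `τ`-datum `D` for `E[3^{k+1}]`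
with cyclotomic transverse conditions and canonical comparison maps for `η`, primes usable for Kato's system
(`hPr`) and Kolyvagin of level `k + N₀ + 1` (`hKol`), and the depth-`k` VALUE rows at exponent `t`: a family
`κ` with `KatoKuriharaWitnessAtTwoExp W k t e D v₃ P κ Λk κ`.  Proof: w2-c3 g6's D6b-u
`exists_isKolyvaginSystem_propagatedSelmerStructure_three_torsionCoeff_of_stable_of_unramified` with
`m := k + N₀`, `hur := hbody.2.1` (NO reduction-type hypothesis, NO bad-place certificate) ⟶ (0), (I4) with
`κ′ = κ`; (Λ) displayed; (DICT3₂) per level by seat acc6's two-exponent value law (acc1's ★ verbatim).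
[cite: MazurRubin2004, App. A Prop. A.2, Remark A.5 and Thm. 3.2.4] [cite: Kato2004Asterisque, (8.1.3) (p. 180), §9.4 (p. 188) and Thm. 9.7 (p. 189)]
[cite: Kim2022StructureSelmer, Thm. 3.13 and §2.2.2, §3.2.3, §3.3–§3.4.1] [cite: Rubin2000, Def. 4.4.4] -/
theorem exists_katoKuriharaWitnessAtTwoExp_of_zetaBody_stable_pow
    {N : ℕ} [NeZero N] (P : ModularParametrizationData W N)
    {ι : (n : ℕ) → (CyclotomicField n ℚ →+* ℂ)} {κK : ℝ}
    {Λ : ∀ (k' : ℕ) (r : Finset (HeightOneSpectrum (𝓞 ℚ))),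
      H1 (tateRep W 3) (cycSubgroup 3 k' r) →ₗ[ℤ_[3]] ℚ_[3] ⊗[ℚ] CyclotomicField (cycLevel 3 k' r) ℚ}
    {c d a : ℤ} {A : ℕ}
    {z : ∀ (k' : ℕ) (r : (cyclotomicLevelsRat 3 (badPlaces c d A N)).Ideals),
      H1 (tateRep W 3) ((cyclotomicLevelsRat 3 (badPlaces c d A N)).level k' r.1)}
    {x : ∀ (k' : ℕ) (r : (cyclotomicLevelsRat 3 (badPlaces c d A N)).Ideals),
      CyclotomicField (cycLevel 3 k' r.1) ℚ}
    (hbody : ZetaBody W 3 P.f ι κK Λ c d a A z x)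
    (hirr : W.HasIrreducibleModPGaloisRep 3)
    {N₀ : ℕ}
    (hstab : ∀ v : HeightOneSpectrum (𝓞 ℚ), ((primesEquiv v : Nat.Primes) : ℕ) = 3 →
      ∀ P : (W.baseChange (v.adicCompletion ℚ)).toAffine.Point, 3 ^ (N₀ + 1) • P = 0 → 3 ^ N₀ • P = 0)
    {k t e α : ℕ} {v₃ : HeightOneSpectrum (𝓞 ℚ)} (hv₃ : ((3 : ℕ) : 𝓞 ℚ) ∈ v₃.asIdeal)
    {Λk : galoisCohomology ((W.torsionGaloisModule (((3 : ℕ) : ℤ) ^ k * ((3 : ℕ) : ℤ))).toLocal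
      (Sum.inr v₃)) 1 →+ ZMod (3 ^ (k + 1))}
    (hΛk : (∀ c : ZMod (3 ^ (k + 1)), ∃ x ∈ propagatedSelmerStructure W 3 k (Sum.inr v₃), Λk x = c) ∧
      (∀ x ∈ propagatedSelmerStructure W 3 k (Sum.inr v₃),
        Λk x = 0 ↔ x ∈ W.kummerSelmerStructure (((3 : ℕ) : ℤ) ^ k * ((3 : ℕ) : ℤ)) (Sum.inr v₃)))
    (hfin₂k : RIDER₂⟦W, k, t, e, v₃, Λ, Λk⟧)
    (D : KolyvaginDatum (W.torsionGaloisModule (((3 : ℕ) : ℤ) ^ k * ((3 : ℕ) : ℤ))))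
    (hT : D.transverse = cyclotomicTransverse (W.torsionGaloisModule (((3 : ℕ) : ℤ) ^ k * ((3 : ℕ) : ℤ))))
    {η : (q : HeightOneSpectrum (𝓞 ℚ)) → (ZMod (Ideal.absNorm q.asIdeal))ˣ}
    (hD : D.HasCanonicalComparison (3 ^ (k + 1)) η)
    (hPr : D.primes ⊆ (cyclotomicLevelsRat 3 (badPlaces c d A N)).primes)
    (hKol : ∀ q ∈ D.primes, Kato.IsKolyvaginPrime W 3 (k + N₀ + 1) ((primesEquiv q : Nat.Primes) : ℕ))
    -- the VALUE ROWS at depth `k`, exponent `t` (T-PK6-VAL's OUT, displayed)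
    (hvalk : ∀ σ : HeightOneSpectrum (𝓞 ℚ) → absoluteGaloisGroup ℚ,
      (∀ q, σ q ∈ (adicCompletionPrime ℚ q).inertia (absoluteGaloisGroup ℚ)) →
      (∀ q, modNCyclotomicCharacter ℚ (Ideal.absNorm q.asIdeal) (σ q) = η q) →
      ∀ (r : Finset (HeightOneSpectrum (𝓞 ℚ))) (hr : (↑r : Set _) ⊆ D.primes),
        ∃ (s : ℤ_[3]) (u : (ZMod (3 ^ (k + 1)))ˣ)
          (ψ : (ℓ : ℕ) → (ZMod ℓ)ˣ →* Multiplicative (ZMod (3 ^ (k + 1)))),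
          (∀ q ∈ r, Function.Surjective (ψ (Ideal.absNorm q.asIdeal))) ∧
          (∃ l ∈ cycIntLattice 3 (cycLevel 3 0 r),
            (((3 : ℕ) : ℤ_[3]) ^ t) • ((1 : ℚ_[3]) ⊗ₜ[ℚ]
              ((r.noncommProd 𝐃F⟦r, σ⟧ (ZetaValue.pairwise_commute_fieldDeriv (cycLevel 3 0 r)
                  (fun ℓ => modNCyclotomicCharacter ℚ (cycLevel 3 0 r) (σ ℓ))
                  (fun ℓ => ((primesEquiv ℓ : Nat.Primes) : ℕ) - 1) r))
                (x 0 ⟨r, fun _ hq => hPr (hr (Finset.mem_coe.2 hq))⟩ +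
                  sigma (cycLevel 3 0 r) (-1) (x 0 ⟨r, fun _ hq => hPr (hr (Finset.mem_coe.2 hq))⟩)))) -
              ((s : ℚ_[3]) ⊗ₜ[ℚ] (1 : CyclotomicField (cycLevel 3 0 r) ℚ)) =
            (((3 : ℕ) : ℤ_[3]) ^ (k + 1)) • (l : ℚ_[3] ⊗[ℚ] CyclotomicField (cycLevel 3 0 r) ℚ)) ∧
          haveI : NeZero (∏ q ∈ r, Ideal.absNorm q.asIdeal) :=
            ⟨Finset.prod_ne_zero_iff.2 fun q _ h => q.ne_bot (Ideal.absNorm_eq_zero_iff.1 h)⟩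
          PadicInt.toZModPow (k + 1) s = (u : ZMod (3 ^ (k + 1))) *
            ((3 : ℕ) : ZMod (3 ^ (k + 1))) ^ t *
              (((3 : ℕ) : ZMod (3 ^ (k + 1))) ^ α *
                kuriharaNumber P.f (3 ^ (k + 1)) (∏ q ∈ r, Ideal.absNorm q.asIdeal) ψ)) :
    ∃ κf : Finset (HeightOneSpectrum (𝓞 ℚ)) →
        galoisCohomology (W.torsionGaloisModule (((3 : ℕ) : ℤ) ^ k * ((3 : ℕ) : ℤ))) 1,
      KatoKuriharaWitnessAtTwoExp W k (t + α) e D v₃ P κf Λk κf := by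
  letI := TorsionCoeff.torsionBy.padicIntModule 3 (k + 1) (WeierstrassCurve.geomPoints W)
  letI := TorsionCoeff.torsionBy.padicIntModule 3 (k + N₀ + 1) (WeierstrassCurve.geomPoints W)
  have hv₃p : ((primesEquiv v₃ : Nat.Primes) : ℕ) = 3 := primesEquiv_eq_of_natCast_mem Nat.prime_three hv₃
  -- T-DER-BP's reduction `E[3^{k+N₀}·3] → E[3^k·3]`, `x ↦ 3^{N₀} x`
  obtain ⟨rd, hrd⟩ := exists_torsionReduction_three W k (k + N₀)
  -- THEOREM D-u at any reduction type (w2-c3 g6's D6b-u on `hstab`): depth `k` family from depth `k + N₀`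
  obtain ⟨σ, Φ, comm, κf, hσI, hσχ, hΦ, hKS, -, hres⟩ :=
    exists_isKolyvaginSystem_propagatedSelmerStructure_three_torsionCoeff_of_stable_of_unramified
      W (badPlaces c d A N) hbody.1 (le_refl (k + N₀)) rd hrd hirr hstab D hT hD hPr hKol hbody.2.1
  refine ⟨κf, fun l hl => hKS.mem_selmerGroup l hl,
    ⟨hKS, fun l _ => by rw [sub_self]; exact zero_mem _⟩, hΛk.1, hΛk.2, fun r hr => ?_⟩
  -- (DICT3₂) at the level `r`: acc6's two-exponent value law on the value row of `(σ, r)`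
  obtain ⟨s, u, ψ, hψ, hval, hw⟩ := hvalk σ hσI hσχ r hr
  have h2 := apply_localization_add_self_eq_toZModPow_of_derivativeFamily_twoExp W 3 P.f ι κK Λ c d a A
    z x hbody hfin₂k (tateModuleRed W 3 (W.continuous_galoisRepTate_holds 3) (k + 1))
    (AddSubgroup.inclusion (geomTorsion_pow_succ_eq W 3 k).le : _ →+ _) continuous_of_discreteTopology
    (fun _ _ => rfl) (fun _ => rfl) D hPr σ Φ comm κf hΦ hKS hres hv₃p r hr s hval
  obtain ⟨u', hu'⟩ := exists_unit_mul_apply_eq_of_add_self 3 (by decide)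
    (Λk.comp (galoisCohomology.localization
      (W.torsionGaloisModule (((3 : ℕ) : ℤ) ^ k * ((3 : ℕ) : ℤ))) (Sum.inr v₃) 1)) (κf r) u h2 hw
  refine ⟨u', ψ, hψ, ?_⟩
  rw [AddMonoidHom.comp_apply] at hu'
  rw [hu']
  push_cast
  ring

/-! ### §2 ★★ The deep-keyed ONE-exponent witness family at any reduction type (shift `N₀`, exponent `t`) -/

set_option backward.isDefEq.respectTransparency false in
/-- **★★ THE DEEP-KEYED WITNESS FAMILY AT ANY REDUCTION TYPE, shifted value rows (`3^α`): witnesses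
`KatoKuriharaWitnessAt W k (t + α) …`.**  For `W/ℚ` globally
minimal with the torsion-stabilisation binder `hstab` of level `N₀` at `3` (any reduction type, `E(ℚ₃)[3]`
unrestricted), `E[3]` irreducible, a parametrisation datum `P`
at the conductor level (`hN`), Kato's witnesses bound by `hbody` for `P.f`, a place `v₃ ∣ 3`, functionals
`Λfin j` with the (Λ)-clauses `hΛ` and the two-exponent riders `hfin₂` at `(j, t, e)` for every depth `j`, the
side condition `hcdA` (no prime `≡ 1 (mod 3)` divides `2cdA`), and the per-level VALUE ROWS at exponent `t`
(`hvalue`, displayed): for EVERY depth `k` and EVERY `τ`-datum `Dk` for `E[3^{k+1}]` canonical for `η` with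
primes in the class of depth `k + N₀` (n1011 (B6) With-guard `IsCanonicalTauDatumThreeAtWith W (k + N₀) k η`),
witnesses `(3^e•κ, Λfin k, 3^e•κ)` with `KatoKuriharaWitnessAt W k t Dk v₃ P …` — EXACTLY the binder shape of
acc1's `deepUpper_conclusion_of_port_e_deep` / `HPortDefectDeep` at `(N₀, t)`.  Proof: the guard gives
Kolyvagin primes of level `k + N₀ + 1` (E1-deep) hence usable primes (`hcdA`, `hN`); §1; acc1's scaling lemma
`katoKuriharaWitnessAt_smul_of_twoExponent` (acc1's ★★ verbatim otherwise).
[cite: Kim2022StructureSelmer, Thm. 3.13, Rem. 3.8, §2.2.2 and §3.2.3] [cite: MazurRubin2004, App. A Prop. A.2 and Thm. 3.2.4]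
[cite: Kato2004Asterisque, (8.1.3) (p. 180), §9.4 (p. 188), Thm. 9.7 (p. 189) and Ex. 13.3 (pp. 224–225)]
[cite: Sakamoto2024, §2 and Def. 4.1] [cite: Kim2025RefinedTNC, §4.2 and §8.1.2] -/
theorem deepWitnessFamily_of_zetaBody_stable_pow
    {N : ℕ} [NeZero N] (P : ModularParametrizationData W N) (hN : N = W.conductorNorm ℤ)
    {ι : (n : ℕ) → (CyclotomicField n ℚ →+* ℂ)} {κK : ℝ}
    {Λ : ∀ (k' : ℕ) (r : Finset (HeightOneSpectrum (𝓞 ℚ))),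
      H1 (tateRep W 3) (cycSubgroup 3 k' r) →ₗ[ℤ_[3]] ℚ_[3] ⊗[ℚ] CyclotomicField (cycLevel 3 k' r) ℚ}
    {c d a : ℤ} {A : ℕ}
    {z : ∀ (k' : ℕ) (r : (cyclotomicLevelsRat 3 (badPlaces c d A N)).Ideals),
      H1 (tateRep W 3) ((cyclotomicLevelsRat 3 (badPlaces c d A N)).level k' r.1)}
    {x : ∀ (k' : ℕ) (r : (cyclotomicLevelsRat 3 (badPlaces c d A N)).Ideals),
      CyclotomicField (cycLevel 3 k' r.1) ℚ}
    (hbody : ZetaBody W 3 P.f ι κK Λ c d a A z x)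
    (hirr : W.HasIrreducibleModPGaloisRep 3)
    {N₀ : ℕ}
    (hstab : ∀ v : HeightOneSpectrum (𝓞 ℚ), ((primesEquiv v : Nat.Primes) : ℕ) = 3 →
      ∀ P : (W.baseChange (v.adicCompletion ℚ)).toAffine.Point, 3 ^ (N₀ + 1) • P = 0 → 3 ^ N₀ • P = 0)
    {t e α : ℕ} {v₃ : HeightOneSpectrum (𝓞 ℚ)} (hv₃ : ((3 : ℕ) : 𝓞 ℚ) ∈ v₃.asIdeal)
    (Λfin : ∀ j : ℕ, galoisCohomology ((W.torsionGaloisModule (((3 : ℕ) : ℤ) ^ j * ((3 : ℕ) : ℤ))).toLocal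
      (Sum.inr v₃)) 1 →+ ZMod (3 ^ (j + 1)))
    (hΛ : ∀ j : ℕ,
      (∀ c : ZMod (3 ^ (j + 1)), ∃ x ∈ propagatedSelmerStructure W 3 j (Sum.inr v₃), Λfin j x = c) ∧
      (∀ x ∈ propagatedSelmerStructure W 3 j (Sum.inr v₃),
        Λfin j x = 0 ↔ x ∈ W.kummerSelmerStructure (((3 : ℕ) : ℤ) ^ j * ((3 : ℕ) : ℤ)) (Sum.inr v₃)))
    (hfin₂ : ∀ j : ℕ, RIDER₂⟦W, j, t, e, v₃, Λ, Λfin j⟧)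
    {η : (q : HeightOneSpectrum (𝓞 ℚ)) → (ZMod (Ideal.absNorm q.asIdeal))ˣ}
    -- the auxiliary datum avoids every prime `≡ 1 (mod 3)` (so every Kolyvagin prime is usable)
    (hcdA : ∀ q : ℕ, q.Prime → q ≡ 1 [MOD 3] → ¬ q ∣ 2 * c.natAbs * d.natAbs * A)
    -- the per-level VALUE ROWS at exponent `t` (T-PK6-VROW's OUT), displayed
    (hvalue : ∀ (j : ℕ) (σ : HeightOneSpectrum (𝓞 ℚ) → absoluteGaloisGroup ℚ),
      (∀ q, σ q ∈ (adicCompletionPrime ℚ q).inertia (absoluteGaloisGroup ℚ)) →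
      (∀ q, modNCyclotomicCharacter ℚ (Ideal.absNorm q.asIdeal) (σ q) = η q) →
      ∀ (r : Finset (HeightOneSpectrum (𝓞 ℚ)))
        (hr : ∀ q ∈ r, q ∈ (cyclotomicLevelsRat 3 (badPlaces c d A N)).primes),
        (∀ q ∈ r, Kato.IsKolyvaginPrime W 3 (j + 1) ((primesEquiv q : Nat.Primes) : ℕ)) →
        (∀ q ∈ r, Subgroup.zpowers (η q) = ⊤) →
        ∃ (s : ℤ_[3]) (u : (ZMod (3 ^ (j + 1)))ˣ)
          (ψ : (ℓ : ℕ) → (ZMod ℓ)ˣ →* Multiplicative (ZMod (3 ^ (j + 1)))),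
          (∀ q ∈ r, Function.Surjective (ψ (Ideal.absNorm q.asIdeal))) ∧
          (∃ l ∈ cycIntLattice 3 (cycLevel 3 0 r),
            (((3 : ℕ) : ℤ_[3]) ^ t) • ((1 : ℚ_[3]) ⊗ₜ[ℚ]
              ((r.noncommProd 𝐃F⟦r, σ⟧ (ZetaValue.pairwise_commute_fieldDeriv (cycLevel 3 0 r)
                  (fun ℓ => modNCyclotomicCharacter ℚ (cycLevel 3 0 r) (σ ℓ))
                  (fun ℓ => ((primesEquiv ℓ : Nat.Primes) : ℕ) - 1) r))
                (x 0 ⟨r, hr⟩ + sigma (cycLevel 3 0 r) (-1) (x 0 ⟨r, hr⟩)))) -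
              ((s : ℚ_[3]) ⊗ₜ[ℚ] (1 : CyclotomicField (cycLevel 3 0 r) ℚ)) =
            (((3 : ℕ) : ℤ_[3]) ^ (j + 1)) • (l : ℚ_[3] ⊗[ℚ] CyclotomicField (cycLevel 3 0 r) ℚ)) ∧
          haveI : NeZero (∏ q ∈ r, Ideal.absNorm q.asIdeal) :=
            ⟨Finset.prod_ne_zero_iff.2 fun q _ h => q.ne_bot (Ideal.absNorm_eq_zero_iff.1 h)⟩
          PadicInt.toZModPow (j + 1) s = (u : ZMod (3 ^ (j + 1))) *
            ((3 : ℕ) : ZMod (3 ^ (j + 1))) ^ t *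
              (((3 : ℕ) : ZMod (3 ^ (j + 1))) ^ α *
                kuriharaNumber P.f (3 ^ (j + 1)) (∏ q ∈ r, Ideal.absNorm q.asIdeal) ψ)) :
    ∀ (k : ℕ) (Dk : KolyvaginDatum (W.torsionGaloisModule (((3 : ℕ) : ℤ) ^ k * ((3 : ℕ) : ℤ)))),
      Dk.IsCanonicalTauDatumThreeAtWith W (k + N₀) k η →
      ∃ (κ : Finset (HeightOneSpectrum (𝓞 ℚ)) →
            galoisCohomology (W.torsionGaloisModule (((3 : ℕ) : ℤ) ^ k * ((3 : ℕ) : ℤ))) 1)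
        (Λ' : galoisCohomology ((W.torsionGaloisModule (((3 : ℕ) : ℤ) ^ k * ((3 : ℕ) : ℤ))).toLocal
            (Sum.inr v₃)) 1 →+ ZMod (3 ^ (k + 1)))
        (κ' : Finset (HeightOneSpectrum (𝓞 ℚ)) →
            galoisCohomology (W.torsionGaloisModule (((3 : ℕ) : ℤ) ^ k * ((3 : ℕ) : ℤ))) 1),
        KatoKuriharaWitnessAt W k (t + α) Dk v₃ P κ Λ' κ' := by
  intro k Dk hDk
  haveI : Fact (Nat.Prime 3) := ⟨Nat.prime_three⟩
  -- the guard: transverse conditions, comparison maps for `η`, primes in the class of depth `k + N₀`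
  obtain ⟨hT, hC, S, τ, hS, hτμ, hτq, hP⟩ := hDk
  -- Kolyvagin primes of level `k + N₀ + 1` (E1-deep on the class of depth `k + N₀`) and of level `k + 1`
  have hKol3 : ∀ q ∈ Dk.primes, Kato.IsKolyvaginPrime W 3 (k + N₀ + 1) ((primesEquiv q : Nat.Primes) : ℕ) :=
    fun q hq => KolyvaginPrime.isKolyvaginPrime_of_mem_frobeniusClassPrimes_of_le W (le_refl (k + N₀))
      (fun v hv => (hS v hv).1) hτμ hτq (hP hq)
  have hKol1 : ∀ q ∈ Dk.primes, Kato.IsKolyvaginPrime W 3 (k + 1) ((primesEquiv q : Nat.Primes) : ℕ) :=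
    fun q hq => KolyvaginPrime.isKolyvaginPrime_of_mem_frobeniusClassPrimes_of_le W (Nat.le_add_right k N₀)
      (fun v hv => (hS v hv).1) hτμ hτq (hP hq)
  -- every Kolyvagin prime is a usable prime of Kato's system for `(c, d, A, N)`
  have hPr : Dk.primes ⊆ (cyclotomicLevelsRat 3 (badPlaces c d A N)).primes := by
    intro q hq
    have hK := hKol1 q hq
    have hℓ := hK.prime
    have h13 : ((primesEquiv q : Nat.Primes) : ℕ) ≡ 1 [MOD 3] :=
      hK.modEq_one.of_dvd (dvd_pow_self 3 (Nat.succ_ne_zero k))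
    refine (mem_primes_cyclotomicLevelsRat_badPlaces_iff 3 c d A N q).2 ⟨fun hdvd => ?_, hK.ne⟩
    rcases (Nat.Prime.dvd_mul hℓ).mp hdvd with h | h
    · exact hcdA _ hℓ h13 h
    · apply hK.not_dvd
      rw [← hN]
      exact dvd_mul_of_dvd_left h 3
  -- §1 at depth `k` on the value rows of the datum's levels
  obtain ⟨κf, hW⟩ := exists_katoKuriharaWitnessAtTwoExp_of_zetaBody_stable_pow W P hbody hirr hstab hv₃ (hΛ k)
    (hfin₂ k) Dk hT hC hPr hKol3
    (fun σ hI hχ r hr => hvalue k σ hI hχ r (fun q hq => hPr (hr (Finset.mem_coe.2 hq)))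
      (fun q hq => hKol1 q (hr (Finset.mem_coe.2 hq)))
      (fun q hq => hC.zpowers_eq_top (hr (Finset.mem_coe.2 hq))))
  -- scale the families by `3^e` (gen 1): the two-exponent law is the one-exponent law of `3^e • κ`
  obtain ⟨h0, ⟨hKS, hbr⟩, hon, hker, hdict⟩ := hW
  refine ⟨_, Λfin k, _, katoKuriharaWitnessAt_smul_of_twoExponent W k e (t + α) Dk v₃ P κf (Λfin k) κf h0 hKS hbr
    hon hker fun l hl => ?_⟩
  obtain ⟨u, ψ, hψ, hL⟩ := hdict l hl
  refine ⟨u, ψ, hψ, ?_⟩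
  push_cast at hL ⊢
  exact hL

/-! ### §3 ★★★ The binder `hstab` discharged: SOME depth shift works on every curve -/

set_option backward.isDefEq.respectTransparency false in
/-- **★★★ THE DEEP-KEYED WITNESS FAMILY, shifted value rows, NO LOCAL HYPOTHESIS AT `3`**: ★★ with
`hstab` discharged (`exists_hstab_three`) — for SOME depth shift `N₀`, at EVERY depth `k` and every `τ`-datum
`Dk` canonical for `η` with primes in the class of depth `k + N₀`, witnesses with
`KatoKuriharaWitnessAt W k t Dk v₃ P κ (Λfin k) κ′` = the `hPort` binder of acc1's END at `(N₀, t)`.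
[cite: MazurRubin2004, App. A Prop. A.2 (p. 79), Remark A.5 and Thm. 3.2.4] [cite: Kim2022StructureSelmer, Thm. 3.13 and §2.2.2]
[cite: Kato2004Asterisque, (8.1.3) (p. 180), §9.4 (p. 188), Thm. 9.7 (p. 189) and Ex. 13.3 (pp. 224–225)] -/
theorem exists_shift_deepWitnessFamily_of_zetaBody_pow
    {N : ℕ} [NeZero N] (P : ModularParametrizationData W N) (hN : N = W.conductorNorm ℤ)
    {ι : (n : ℕ) → (CyclotomicField n ℚ →+* ℂ)} {κK : ℝ}
    {Λ : ∀ (k' : ℕ) (r : Finset (HeightOneSpectrum (𝓞 ℚ))),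
      H1 (tateRep W 3) (cycSubgroup 3 k' r) →ₗ[ℤ_[3]] ℚ_[3] ⊗[ℚ] CyclotomicField (cycLevel 3 k' r) ℚ}
    {c d a : ℤ} {A : ℕ}
    {z : ∀ (k' : ℕ) (r : (cyclotomicLevelsRat 3 (badPlaces c d A N)).Ideals),
      H1 (tateRep W 3) ((cyclotomicLevelsRat 3 (badPlaces c d A N)).level k' r.1)}
    {x : ∀ (k' : ℕ) (r : (cyclotomicLevelsRat 3 (badPlaces c d A N)).Ideals),
      CyclotomicField (cycLevel 3 k' r.1) ℚ}
    (hbody : ZetaBody W 3 P.f ι κK Λ c d a A z x)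
    (hirr : W.HasIrreducibleModPGaloisRep 3)
    {t e α : ℕ} {v₃ : HeightOneSpectrum (𝓞 ℚ)} (hv₃ : ((3 : ℕ) : 𝓞 ℚ) ∈ v₃.asIdeal)
    (Λfin : ∀ j : ℕ, galoisCohomology ((W.torsionGaloisModule (((3 : ℕ) : ℤ) ^ j * ((3 : ℕ) : ℤ))).toLocal
      (Sum.inr v₃)) 1 →+ ZMod (3 ^ (j + 1)))
    (hΛ : ∀ j : ℕ,
      (∀ c : ZMod (3 ^ (j + 1)), ∃ x ∈ propagatedSelmerStructure W 3 j (Sum.inr v₃), Λfin j x = c) ∧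
      (∀ x ∈ propagatedSelmerStructure W 3 j (Sum.inr v₃),
        Λfin j x = 0 ↔ x ∈ W.kummerSelmerStructure (((3 : ℕ) : ℤ) ^ j * ((3 : ℕ) : ℤ)) (Sum.inr v₃)))
    (hfin₂ : ∀ j : ℕ, RIDER₂⟦W, j, t, e, v₃, Λ, Λfin j⟧)
    {η : (q : HeightOneSpectrum (𝓞 ℚ)) → (ZMod (Ideal.absNorm q.asIdeal))ˣ}
    (hcdA : ∀ q : ℕ, q.Prime → q ≡ 1 [MOD 3] → ¬ q ∣ 2 * c.natAbs * d.natAbs * A)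
    (hvalue : ∀ (j : ℕ) (σ : HeightOneSpectrum (𝓞 ℚ) → absoluteGaloisGroup ℚ),
      (∀ q, σ q ∈ (adicCompletionPrime ℚ q).inertia (absoluteGaloisGroup ℚ)) →
      (∀ q, modNCyclotomicCharacter ℚ (Ideal.absNorm q.asIdeal) (σ q) = η q) →
      ∀ (r : Finset (HeightOneSpectrum (𝓞 ℚ)))
        (hr : ∀ q ∈ r, q ∈ (cyclotomicLevelsRat 3 (badPlaces c d A N)).primes),
        (∀ q ∈ r, Kato.IsKolyvaginPrime W 3 (j + 1) ((primesEquiv q : Nat.Primes) : ℕ)) →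
        (∀ q ∈ r, Subgroup.zpowers (η q) = ⊤) →
        ∃ (s : ℤ_[3]) (u : (ZMod (3 ^ (j + 1)))ˣ)
          (ψ : (ℓ : ℕ) → (ZMod ℓ)ˣ →* Multiplicative (ZMod (3 ^ (j + 1)))),
          (∀ q ∈ r, Function.Surjective (ψ (Ideal.absNorm q.asIdeal))) ∧
          (∃ l ∈ cycIntLattice 3 (cycLevel 3 0 r),
            (((3 : ℕ) : ℤ_[3]) ^ t) • ((1 : ℚ_[3]) ⊗ₜ[ℚ]
              ((r.noncommProd 𝐃F⟦r, σ⟧ (ZetaValue.pairwise_commute_fieldDeriv (cycLevel 3 0 r)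
                  (fun ℓ => modNCyclotomicCharacter ℚ (cycLevel 3 0 r) (σ ℓ))
                  (fun ℓ => ((primesEquiv ℓ : Nat.Primes) : ℕ) - 1) r))
                (x 0 ⟨r, hr⟩ + sigma (cycLevel 3 0 r) (-1) (x 0 ⟨r, hr⟩)))) -
              ((s : ℚ_[3]) ⊗ₜ[ℚ] (1 : CyclotomicField (cycLevel 3 0 r) ℚ)) =
            (((3 : ℕ) : ℤ_[3]) ^ (j + 1)) • (l : ℚ_[3] ⊗[ℚ] CyclotomicField (cycLevel 3 0 r) ℚ)) ∧
          haveI : NeZero (∏ q ∈ r, Ideal.absNorm q.asIdeal) :=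
            ⟨Finset.prod_ne_zero_iff.2 fun q _ h => q.ne_bot (Ideal.absNorm_eq_zero_iff.1 h)⟩
          PadicInt.toZModPow (j + 1) s = (u : ZMod (3 ^ (j + 1))) *
            ((3 : ℕ) : ZMod (3 ^ (j + 1))) ^ t *
              (((3 : ℕ) : ZMod (3 ^ (j + 1))) ^ α *
                kuriharaNumber P.f (3 ^ (j + 1)) (∏ q ∈ r, Ideal.absNorm q.asIdeal) ψ)) :
    ∃ N₀ : ℕ, ∀ (k : ℕ) (Dk : KolyvaginDatum (W.torsionGaloisModule (((3 : ℕ) : ℤ) ^ k * ((3 : ℕ) : ℤ)))),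
      Dk.IsCanonicalTauDatumThreeAtWith W (k + N₀) k η →
      ∃ (κ : Finset (HeightOneSpectrum (𝓞 ℚ)) →
            galoisCohomology (W.torsionGaloisModule (((3 : ℕ) : ℤ) ^ k * ((3 : ℕ) : ℤ))) 1)
        (Λ' : galoisCohomology ((W.torsionGaloisModule (((3 : ℕ) : ℤ) ^ k * ((3 : ℕ) : ℤ))).toLocal
            (Sum.inr v₃)) 1 →+ ZMod (3 ^ (k + 1)))
        (κ' : Finset (HeightOneSpectrum (𝓞 ℚ)) →
            galoisCohomology (W.torsionGaloisModule (((3 : ℕ) : ℤ) ^ k * ((3 : ℕ) : ℤ))) 1),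
        KatoKuriharaWitnessAt W k (t + α) Dk v₃ P κ Λ' κ' := by
  obtain ⟨N₀, hstab⟩ := exists_hstab_three W
  exact ⟨N₀, deepWitnessFamily_of_zetaBody_stable_pow W P hN hbody hirr hstab hv₃ Λfin hΛ hfin₂ hcdA hvalue⟩

end Summit.BirchSwinnertonDyer.BirchSwinnertonDyer.Theorems.KimAtThreeDeepUpperWitnessOfZetaBodyPow

end
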